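import Summits.AtomisticToContinuum.HydrodynamicLimit.Theorems.CollisionIsometryCLTAdaptedWeightCLTLine

/-!
# The closure debt of `stub_contactCrossNull` / `stub_sourceContraction`, checked on the line's own `chaosCross` —
negative knowledge for the line `contact-source-duhamel` of the crux `CollisionIsometryCLT.AdaptedWeightCLT`

Negative-lane support file for the crux `AdaptedWeightCLT` (stmt-AtomisticToContinuum-14868, route
`CollisionIsometryCLT`), line `contact-source-duhamel` (lead `prover-line-stmt-AtomisticToContinuum-14868-0`, landed
vocabulary `Theorems/CollisionIsometryCLTAdaptedWeightCLTLine.lean`), from the standing disprover's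
`Cruxes/AdaptedWeightCLT/Disproof.lean` §5b (cycle 3; refuter-cdisprove-stmt-AtomisticToContinuum-14868-0).

A refutation of the natural strengthening "the chaos value of the contact sources is controlled by the visible Euler
defect `|D|² + |q|²`": for the REGULAR-TETRAHEDRON block law `tet` (four velocities, equal weights, shift `u = 0` = its
mean) the traceless kinetic stress `D` and the kinetic heat flux `q` vanish EXACTLY (`tet_sum`, `tet_second`,
`tet_flux`), yet the line's `chaosCross 2` — the flux-weighted (`|⟪W_k − W_k', n⟫|`) pair average of the rank-2 contact
source `crossT 2 (Q ỹ) (P ỹ')` given the normal — at `n = (1,2,0)` has `(0,0)` entry `4/125 ≠ 0`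
(`chaosCross_tet_ne_zero`; it vanishes at the symmetry normals `e_p`, `e_p ± e_q`, `e₀+e₁+e₂`).  Consequences for the
line: (i) `|D|²+|q|² = 0` at time `s` does not make the chaos value `Ξ^ch` of the sources injected during `[s, s+Δℓ]`
small — closed Euler fluxes can be re-opened at the collision rate by a flux-weighted fourth-cumulant anisotropy;
(ii) given the Duhamel identity, the flow dictionary and `PastSmallOn` (and even the crux's conclusion C),
`CrossNullOn ⟺ ∫∫ Σ_b (Ξ^ch_b)² → 0`, which is NOT a consequence of C nor of the kinetic hinge stmt-9522: CCN and SC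
assert local equilibrium of the block law in the flux-weighted bilinear sense along the flow, strictly more than
rank-2/3 moment closure; (iii) no pointwise inequality `Σ(Ξ^ch)² ≤ κ(|D|²+|q|²)` or `Σ Blk·Ξ^ch ≤ κ(|D|²+|q|²) − c Σ(Ξ^ch)²`
holds (here the right-hand sides vanish) — only the in-probability, along-the-flow forms the line card states can.
Also recorded: `crossT_two_apply`, the rank-2 cross terms in closed form (`crossT 2 a b = a ⊗ b + b ⊗ a`).
-/

noncomputable section

namespace Summit.AtomisticToContinuum.HydrodynamicLimit.Theorems

namespace AdaptedWeightCLTNegative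

open scoped BigOperators InnerProductSpace
open Finset Summit.AtomisticToContinuum.HydrodynamicLimit.Theorems.ContactSourceDuhamel



/-- The two non-trivial slot subsets at rank 2. [folklore] -/
theorem filter_subsets_two :
    (Finset.univ.filter (fun S : Finset (Fin 2) => S ≠ ∅ ∧ S ≠ Finset.univ)) = {{0}, {1}} := by
  decide

/-- The rank-2 cross terms in closed form: `crossT 2 a b = a ⊗ b + b ⊗ a` (entrywise). [folklore] -/
theorem crossT_two_apply (a b : V3) (idx : Fin 2 → Fin 3) :
    crossT 2 a b idx = b (idx 0) * a (idx 1) + a (idx 0) * b (idx 1) := by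
  rw [crossT, filter_subsets_two, Finset.sum_pair (by decide), Fin.prod_univ_two, Fin.prod_univ_two]
  simp

/-- The four velocities of the REGULAR TETRAHEDRON law (equal weights): centred, second moments `4·𝟙`
(so the traceless stress `D` vanishes), `Σ |y|² y = 0` (so the heat flux `q` vanishes).  A local notation, so that
this file stays definitions-free. -/
local notation "tet" =>
  (![!₂[(1 : ℝ), 1, 1], !₂[(1 : ℝ), -1, -1], !₂[(-1 : ℝ), 1, -1], !₂[(-1 : ℝ), -1, 1]] : Fin 4 → EuclideanSpace ℝ (Fin 3))

/-- The contact normal `(1, 2, 0)` of the witness (local notation). -/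
local notation "ntet" => (!₂[(1 : ℝ), 2, 0] : EuclideanSpace ℝ (Fin 3))

/-- Coordinates of the tetrahedron velocities. [folklore] -/
theorem tet_apply (k : Fin 4) (c : Fin 3) :
    tet k c = (![![1, 1, 1], ![1, -1, -1], ![-1, 1, -1], ![-1, -1, 1]] : Fin 4 → Fin 3 → ℝ) k c := by
  fin_cases k <;> fin_cases c <;> rfl

/-- Coordinates of the witness normal. [folklore] -/
theorem ntet_apply (c : Fin 3) : ntet c = (![1, 2, 0] : Fin 3 → ℝ) c := by
  fin_cases c <;> rfl

/-- `⟪n, y⟫ = y₀ + 2 y₁` for the witness normal. [folklore] -/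
theorem inner_ntet (y : V3) : ⟪ntet, y⟫_ℝ = y 0 + 2 * y 1 := by
  simp only [PiLp.inner_apply, RCLike.inner_apply, conj_trivial, Fin.sum_univ_three]
  simp; ring

/-- `‖n‖² = 5` for the witness normal. [folklore] -/
theorem norm_ntet_sq : ‖ntet‖ ^ 2 = 5 := by
  rw [← real_inner_self_eq_norm_sq, inner_ntet]; simp; norm_num

/-- tetrahedron law: centred. [folklore] -/
theorem tet_sum : ∑ k, tet k = 0 := by
  ext c
  simp only [Fin.sum_univ_four, PiLp.add_apply, PiLp.zero_apply, tet_apply]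
  fin_cases c <;> simp

/-- tetrahedron law: isotropic second moments `Σ_k y_k ⊗ y_k = 4·𝟙` (`D = 0` for the shift `u = 0`). [folklore] -/
theorem tet_second (j l : Fin 3) : ∑ k, tet k j * tet k l = if j = l then 4 else 0 := by
  simp only [Fin.sum_univ_four, tet_apply]
  fin_cases j <;> fin_cases l <;> simp <;> norm_num

/-- tetrahedron law: vanishing heat flux `Σ_k |y_k|² y_k = 0` (all `|y_k|² = 3`). [folklore] -/
theorem tet_flux (a : Fin 3) : ∑ k, ‖tet k‖ ^ 2 * tet k a = 0 := by
  have h : ∀ k, ‖tet k‖ ^ 2 = 3 := by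
    intro k
    rw [EuclideanSpace.real_norm_sq_eq, Fin.sum_univ_three]
    fin_cases k <;> simp <;> norm_num
  simp only [h, Fin.sum_univ_four, tet_apply]
  fin_cases a <;> simp

/-- **Closure-debt witness.** For the tetrahedron block law (weights `1`, shift `u = 0`, so `D = 0` and `q = 0`
exactly: `tet_sum`, `tet_second`, `tet_flux`) the CHAOS VALUE of the rank-2 contact source at the normal
`n = (1,2,0)` does not vanish: its `(0,0)` entry is `4/125`. [folklore] -/
theorem chaosCross_tet_ne_zero :
    chaosCross 2 3 (fun _ => (1 : ℝ)) tet 0 ntet (fun _ => 0) = 4 / 125 := by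
  have hP : ∀ y : V3, projV ntet y 0 = (y 0 + 2 * y 1) / 5 := by
    intro y; simp [projV, inner_ntet, norm_ntet_sq]
  have hQ : ∀ y : V3, coprojV ntet y 0 = y 0 - (y 0 + 2 * y 1) / 5 := by
    intro y; simp [coprojV, hP]
  have hs : ∀ k, ⟪tet k, ntet⟫_ℝ = (![3, -1, 1, -3] : Fin 4 → ℝ) k := by
    intro k; rw [real_inner_comm, inner_ntet, tet_apply, tet_apply]
    fin_cases k <;> simp <;> norm_num
  have hw : ∀ k k', |⟪tet k, ntet⟫_ℝ - ⟪tet k', ntet⟫_ℝ| =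
      (![![0, 4, 2, 6], ![4, 0, 2, 2], ![2, 2, 0, 4], ![6, 2, 4, 0]] : Fin 4 → Fin 4 → ℝ) k k' := by
    intro k k'; rw [hs, hs]
    fin_cases k <;> fin_cases k' <;> simp <;> norm_num
  have h0 : ∀ k, tet k 0 = (![1, 1, -1, -1] : Fin 4 → ℝ) k := by
    intro k; rw [tet_apply]; fin_cases k <;> simp
  have h1 : ∀ k, tet k 1 = (![1, -1, 1, -1] : Fin 4 → ℝ) k := by
    intro k; rw [tet_apply]; fin_cases k <;> simp
  simp only [chaosCross, crossT_two_apply, hP, hQ, sub_zero, one_mul, inner_sub_left, hw, h0, h1]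
  simp only [Fin.sum_univ_succ, Fin.sum_univ_zero]
  simp
  norm_num


/-- **Closure-debt witness, packaged.** There is a finite block law (four velocities `W`, equal weights, shift `0`)
with `Σ W = 0`, isotropic second moments `Σ W_j W_l = 4 δ_{jl}` (so `D = 0`) and `Σ |W|² W = 0` (so `q = 0`) whose
chaos value `chaosCross 2` (the line's flux-weighted pair average of the rank-2 contact source) at some normal has a
non-zero entry: `|D|² + |q|² = 0` does not control `Ξ^ch`; `CrossNullOn` / `SourceContractionOn` are not consequences
of the kinetic closure C (nor of stmt-9522) and admit no pointwise form with margin. [folklore] -/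
theorem closure_debt_witness :
    ∃ (W : Fin (3 + 1) → V3) (n : V3),
      (∑ k, W k = 0) ∧ (∀ j l : Fin 3, ∑ k, W k j * W k l = if j = l then 4 else 0) ∧
      (∀ a : Fin 3, ∑ k, ‖W k‖ ^ 2 * W k a = 0) ∧
      chaosCross 2 3 (fun _ => (1 : ℝ)) W 0 n (fun _ => 0) ≠ 0 :=
  ⟨tet, ntet, tet_sum, tet_second, tet_flux, by rw [chaosCross_tet_ne_zero]; norm_num⟩

end AdaptedWeightCLTNegative

end Summit.AtomisticToContinuum.HydrodynamicLimit.Theorems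

end
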